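import Literature.Computability.AlgebraicComplexity.MatMulOccurrenceObstructionsProofs
import Literature.Combinatorics.SimpleGraph.WilfChromaticBound
import HarnessLib

/-!
# Obstruction designs, their chromatic index, and the ceiling `χ'(H) ≤ 3n − 2` of the method (Bürgisser–Ikenmeyer, STOC 2013, §4.2–§4.4)

Topic `Literature/Computability/AlgebraicComplexity` (geometric complexity theory, tensor setting).
Typed-chain item of the cell `pub-gct-max` (track T, seat lit-2): §4.2–§4.4 of P. Bürgisser,
C. Ikenmeyer, *Explicit lower bounds via geometric complexity theory*, STOC 2013, pp. 141–150 =
arXiv:1210.8368 [BurgisserIkenmeyer2013], AS PRINTED, together with the dictionary to the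
tableau-triple form in which the tree proves the vanishing mechanism of their Prop. 4.2
(`MatMulOccurrenceObstructionsProofs.lean`). Honest framing of the cell: this file records what
ONE printed method (occurrence obstructions certified through the chromatic index of an
obstruction design) can and cannot show — bookkeeping of a cited, printed theorem; multiplicity
data and certified rank bounds at small parameters; occurrence obstructions are ruled out in print
for determinant versus padded permanent (BIP 2019, tree theorem
`Literature.Computability.Complexity.no_occurrence_obstructions_holds`) — nothing here is a claim
on VP vs VNP or P vs NP.

## What is printed (arXiv:1210.8368; STOC numbering Prop. 4.2 / Lemma 4.3 / §4.4)

* §4.2: "We define an *obstruction design* as a subset `H ⊆ [ℓ₁]×[ℓ₂]×[ℓ₃]` of the discrete box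
  of side lengths `ℓ₁, ℓ₂, ℓ₃`, respectively. The `1`-slices of `H` are defined as the sets
  `e⁽¹⁾ᵢ := {(i,j,k) ∈ H ∣ j ∈ [ℓ₂], k ∈ [ℓ₃]}` for `i ∈ [ℓ₁]`. … Similarly, we define the set
  partition `E⁽²⁾` of `2`-slices of `H` … and the set partition `E⁽³⁾` of `3`-slices"; "Note that
  `|e⁽¹⁾ ∩ e⁽²⁾ ∩ e⁽³⁾| ≤ 1`"; the *type* of `H` is the triple `λ = (λ⁽¹⁾, λ⁽²⁾, λ⁽³⁾)`,
  `λ⁽ᵏ⁾ := ᵗμ⁽ᵏ⁾` the transpose of the sorted `k`-th marginal (slice sizes); "If all slices contain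
  at most `n` elements, we have `λ ⊢*_n d`" (`d = |H|`).
* §4.3: "By a *proper coloring* of an obstruction design `H` with `c` colors we shall understand
  a map `σ : H → [c]` such that in each slice of `H`, the colors of points are pairwise different.
  The *chromatic index* `χ'(H)` is defined as the least number of colors sufficient for coloring
  `H`." **Prop. 4.2**: "Let `H` be an obstruction design of type `λ ⊢*_n d`. Then we have
  `f_H(w) = 0` for all tensors `w ∈ ⊗³ℂⁿ` satisfying `R̲(w) < χ'(H)`." Proof: "If
  `r = |T| < χ'(H)`, then a map `J : H → T` cannot be a proper coloring of `H`. Hence there exists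
  some `k` and some slice `e ∈ E⁽ᵏ⁾` in which two points get the same color. As a consequence,
  the matrix `J⁽ᵏ⁾|e` has a duplicated column and hence `det J⁽ᵏ⁾|e = 0`."
  **Lemma 4.3**: "We have `χ'(H) ≤ 3n − 2` for any obstruction design of type `λ ⊢*_n d`."
  Proof: "`χ'(H)` equals the chromatic number of the graph `G` with vertex set `H`, in which two
  nodes are connected iff they lie in a same slice. Each node in this graph has degree at most
  `Δ = 3(n−1)`, since there are at most `n` nodes in each slice. It is well known from graph theory
  that `1 + Δ` is an upper bound on the chromatic number of `G`." Followed by: "This result shows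
  that `3n−2` is the best lower bound on border rank that can be shown based on Proposition 4.2.
  Unfortunately, the limit seems even smaller." and the sentence on the Alon–Kim conjecture
  ("if this conjecture is true, `(3/2)n + o(n)` is the best possible lower bound on border rank that
  can be shown based on Proposition 4.2") — a CONJECTURE, quoted here only.
* §4.4: "Consider the obstruction design `H_κ := {(i,j,k) ∈ [κ+1]³ ∣ i = 1 or j = 1 or k = 1}`
  given by a '3-dimensional hook' (`κ ∈ ℕ`). Its type `λ(κ)` is the triple with components three
  times the hook partition `(κ+1, 1, …, 1) ⊢_{2κ+1} 3κ+1`. It is obvious that `χ'(H_κ) = 3κ+1`."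
  **Reading of the set-builder.** The set literally printed has `(κ+1)³ − κ³ = 3κ² + 3κ + 1`
  points, whereas a design of type `λ(κ)` has `|λ(κ)| = 3κ + 1` points; §6 of the paper describes
  `H_κ` as "`V(H)` is partitioned into disjoint sets `V⁽¹⁾ ∪ V⁽²⁾ ∪ V⁽³⁾ ∪ {y⁰}`, where
  `|V⁽ᵏ⁾| = κ` for all `k`. Each `E⁽ᵏ⁾` consists of one hyperedge `e⁽ᵏ⁾ ⊇ V⁽ᵏ⁺¹⁾ ∪ V⁽ᵏ⁺²⁾ ∪ {y⁰}`
  of size `2κ+1` … and `κ` singletons." The design with these slices, of type `λ(κ)` and with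
  `3κ + 1` points, is the union of the three coordinate AXES of the cube `[κ+1]³` through the
  corner `(1,1,1)`, i.e. the points with AT LEAST TWO coordinates equal to `1` — the "or" of the
  printed formula is to be read this way; `hookDesign κ` below is that set (with `0`-based
  coordinates), and `card_hookDesign` / `chromaticIndex_hookDesign` check `|H_κ| = χ'(H_κ) = 3κ+1`.

## What is here

* §1 (definitions AS PRINTED, `0`-based coordinates): `ObstructionDesign` (a finite set of points
  of `ℕ³`; the ambient box plays no role), `coord`, `slice`, `SameSlice`, `SlicesAtMost H n`
  (= "all slices contain at most `n` elements", i.e. `λ ⊢*_n`: `ℓ(λ⁽ᵏ⁾) = ᵗμ⁽ᵏ⁾₁` is the largest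
  `k`-slice), `IsProperColoring`, `chromaticIndex` (`χ'`), with the API one expects (a colouring
  with `|H|` colours, an optimal colouring, `χ' ≤ |H|`, pairwise-conflicting points force
  `|H| ≤ χ'`).
* §2 **Lemma 4.3 PROVED** (`chromaticIndex_le`): `χ'(H) ≤ 3n − 2` whenever all slices of `H` have
  at most `n` points — by the printed proof: the conflict graph on `H` (Mathlib `SimpleGraph.fromRel`)
  has all degrees `≤ 3(n−1)` and the tree's greedy bound
  `Literature.Combinatorics.SimpleGraph.WilfChromaticBound.colorable_maxDegree_succ` (`χ ≤ Δ + 1`)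
  colours it; and the printed gloss `not_lt_chromaticIndex_of_le` ("`3n − 2` is the best lower
  bound on border rank that can be shown based on Proposition 4.2": for `r ≥ 3n − 2` the hypothesis
  `r < χ'(H)` of Prop. 4.2 is never met).
* §3 The combinatorial half of the proof of Prop. 4.2 (`exists_eq_of_lt_chromaticIndex`): if
  `r < χ'(H)` then every labeling of `H` by `r` colours gives two distinct points of a common slice
  the same colour.
* §4 `hookDesign κ` (the three axes, see above): `card_hookDesign` (`3κ+1` points),
  `slicesAtMost_hookDesign` (slices have `≤ 2κ+1` points, so the type is `⊢*_{2κ+1}`),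
  `chromaticIndex_hookDesign` (`χ'(H_κ) = 3κ+1`, "It is obvious": every two points share a slice).
* §5 The dictionary to the tree's tableau triples (BI Thm. 4.1 / §5: a design `H ≅ [d]` with its
  three slice partitions is a triple of column-fillings; here, conversely, a triple of standard
  fillings `T₁, T₂, T₃ : [d] → cells` has the design `designOf T₁ T₂ T₃ = {(col_{T₁} p, col_{T₂} p,
  col_{T₃} p) : p < d}`, whose `k`-slices are the columns of `T_k`; BI's intersection property
  `|e⁽¹⁾ ∩ e⁽²⁾ ∩ e⁽³⁾| ≤ 1` is the injectivity of `p ↦ (col p)ₖ`): `slicesAtMost_designOf` (at most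
  `n` rows ⇒ slices `≤ n`), hence Lemma 4.3 for tableau triples (`chromaticIndex_designOf_le`), and
  **Prop. 4.2 in the tree's occurrence language** (`tripleSum_eq_zero_of_lt_chromaticIndex`): for
  `r < χ'(designOf T₁ T₂ T₃)` and all `r × r` matrices `A, B, C`, the pairing
  `∑_{I : [d] → [r]} ⟨⊗ a_I, e_{T₁}⟩ ⟨⊗ b_I, e_{T₂}⟩ ⟨⊗ c_I, e_{T₃}⟩` of `((A⊗B⊗C)·⟨r⟩)^{⊗d}` with
  `e_{T₁} ⊗ e_{T₂} ⊗ e_{T₃}` vanishes — by §3 and the tree's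
  `sum_prod_mul_polytabloid_eq_zero_of_apply_eq` ("duplicated column ⇒ `det = 0`") when the
  column-triple map is injective, and by the tree's `tripleSum_eq_zero_of_common_column` otherwise;
  with `pairing_unitTensor_eq_sum` / `exists_pairing_ne_zero_of_isotypicSum₁₂₃_kroneckerPow_ne_zero`
  (tree) this is the statement "`f_H` vanishes on `\overline{GL_r³ E_r}`" for `r < χ'(H)`.

## Deliberately NOT here

The type of a design as a partition triple (sorting and transposing the marginals — only the
length bound `⊢*_n` enters §4.3), `f_H` as a named polynomial and Thm. 4.1 (the `f_H` SPAN the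
highest-weight vectors; §5 of the paper), Cor. 4.8 (`k(λ) ≤ N(λ)`), Prop. 4.9 (NP-completeness of
the existence of a design of given type), Example 4.10 (Latin squares), Lemma 4.4 / Thm. 4.5 /
Rem. 4.7 (in `MatMulOccurrenceObstructions*.lean`), and the Alon–Kim sentence (a conjecture).

## References

* [BurgisserIkenmeyer2013] P. Bürgisser, C. Ikenmeyer, *Explicit lower bounds via geometric
  complexity theory*, STOC 2013, 141–150 = arXiv:1210.8368: §4.1 (notation `λ ⊢*_n d`), §4.2
  (obstruction designs, slices, type, triple labelings, (4.2)), §4.3 (proper colorings, `χ'`,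
  Prop. 4.2, Lemma 4.3 and the two sentences after it), §4.4 (`H_κ`, `λ(κ)`), §6 (description of
  `H_κ` by `V⁽¹⁾, V⁽²⁾, V⁽³⁾, y⁰`).
* R. Diestel, *Graph Theory*, GTM 173, §5.2 (greedy colouring `χ ≤ Δ + 1`) — through the tree file
  `Literature/Combinatorics/SimpleGraph/WilfChromaticBound.lean`.

## Tree

`MatMulOccurrenceObstructionsProofs` (`sum_prod_mul_polytabloid_eq_zero_of_apply_eq`,
`tripleSum_eq_zero_of_common_column`), `StandardFillings` (`StdFilling`, `.mem`, `.injective`),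
`SchurWeylPlethysmHwMultiplicityProofs` (`StdFilling.polytabloid`), `TensorWordModel` (`Word`),
`WilfChromaticBound` (`colorable_maxDegree_succ`). Mathlib: `SimpleGraph.fromRel`,
`SimpleGraph.Colorable.mono`, `SimpleGraph.colorable_iff_exists_bdd_nat_coloring`,
`SimpleGraph.maxDegree_le_of_forall_degree_le`, `Finset.card_biUnion_le`,
`Finset.card_le_card_of_injOn`, `Nat.sInf_mem`, `Nat.sInf_le`.
-/

open scoped BigOperators

namespace Literature.Computability.AlgebraicComplexity

/-! ## §1 Obstruction designs, slices, proper colorings, chromatic index (BI 2013, §4.2–§4.3) -/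

/-- An **obstruction design**: "a subset `H ⊆ [ℓ₁]×[ℓ₂]×[ℓ₃]` of the discrete box of side
lengths `ℓ₁, ℓ₂, ℓ₃`" — a finite set of points with three coordinates (`0`-based here; the
ambient box is irrelevant for everything in this file). [cite: BurgisserIkenmeyer2013, §4.2] -/
abbrev ObstructionDesign : Type := Finset (ℕ × ℕ × ℕ)

namespace ObstructionDesign

/-- The `k`-th coordinate of a point, `k ∈ {0, 1, 2}` (BI's `i`, `j`, `k` of `(i,j,k)`).
[cite: BurgisserIkenmeyer2013, §4.2] -/
def coord (k : Fin 3) (x : ℕ × ℕ × ℕ) : ℕ := ![x.1, x.2.1, x.2.2] k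

/-- `coord 0 (i,j,k) = i`. [cite: BurgisserIkenmeyer2013, §4.2] -/
@[simp] theorem coord_zero (x : ℕ × ℕ × ℕ) : coord 0 x = x.1 := rfl

/-- `coord 1 (i,j,k) = j`. [cite: BurgisserIkenmeyer2013, §4.2] -/
@[simp] theorem coord_one (x : ℕ × ℕ × ℕ) : coord 1 x = x.2.1 := rfl

/-- `coord 2 (i,j,k) = k`. [cite: BurgisserIkenmeyer2013, §4.2] -/
@[simp] theorem coord_two (x : ℕ × ℕ × ℕ) : coord 2 x = x.2.2 := rfl

/-- The **`k`-slice** of `H` through the index `i`: "`e⁽¹⁾ᵢ := {(i,j,k) ∈ H ∣ j ∈ [ℓ₂], k ∈ [ℓ₃]}`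
for `i ∈ [ℓ₁]`" and similarly for `k = 2, 3` — the points of `H` whose `k`-th coordinate is `i`
(possibly empty; BI omit the empty slices from the set partition `E⁽ᵏ⁾`).
[cite: BurgisserIkenmeyer2013, §4.2] -/
def slice (H : ObstructionDesign) (k : Fin 3) (i : ℕ) : Finset (ℕ × ℕ × ℕ) :=
  H.filter fun x => coord k x = i

/-- Membership in a slice. [cite: BurgisserIkenmeyer2013, §4.2] -/
theorem mem_slice {H : ObstructionDesign} {k : Fin 3} {i : ℕ} {x : ℕ × ℕ × ℕ} :
    x ∈ H.slice k i ↔ x ∈ H ∧ coord k x = i :=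
  Finset.mem_filter

/-- A slice is a subset of the design. [cite: BurgisserIkenmeyer2013, §4.2] -/
theorem slice_subset (H : ObstructionDesign) (k : Fin 3) (i : ℕ) : H.slice k i ⊆ H :=
  Finset.filter_subset _ _

/-- Every point of `H` lies in its own three slices. [cite: BurgisserIkenmeyer2013, §4.2] -/
theorem mem_slice_self {H : ObstructionDesign} {x : ℕ × ℕ × ℕ} (hx : x ∈ H) (k : Fin 3) :
    x ∈ H.slice k (coord k x) :=
  mem_slice.2 ⟨hx, rfl⟩

/-- Two points **lie in a common slice** (of any design containing both) iff they agree in one of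
the three coordinates. [cite: BurgisserIkenmeyer2013, §4.2–§4.3] -/
def SameSlice (x y : ℕ × ℕ × ℕ) : Prop :=
  ∃ k : Fin 3, coord k x = coord k y

/-- `SameSlice` is decidable (three coordinate comparisons). [cite: BurgisserIkenmeyer2013, §4.2] -/
instance : DecidableRel SameSlice := fun x y =>
  inferInstanceAs (Decidable (∃ k : Fin 3, coord k x = coord k y))

/-- `SameSlice` spelled out on the three coordinates. [cite: BurgisserIkenmeyer2013, §4.2] -/
theorem sameSlice_iff {x y : ℕ × ℕ × ℕ} :
    SameSlice x y ↔ x.1 = y.1 ∨ x.2.1 = y.2.1 ∨ x.2.2 = y.2.2 := by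
  constructor
  · rintro ⟨k, hk⟩
    fin_cases k
    · exact Or.inl hk
    · exact Or.inr (Or.inl hk)
    · exact Or.inr (Or.inr hk)
  · rintro (h | h | h)
    exacts [⟨0, h⟩, ⟨1, h⟩, ⟨2, h⟩]

/-- `SameSlice` is symmetric. [cite: BurgisserIkenmeyer2013, §4.2] -/
theorem SameSlice.symm {x y : ℕ × ℕ × ℕ} (h : SameSlice x y) : SameSlice y x := by
  obtain ⟨k, hk⟩ := h
  exact ⟨k, hk.symm⟩

/-- Two points of `H` lie in a common slice iff some slice of `H` contains both.
[cite: BurgisserIkenmeyer2013, §4.2] -/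
theorem sameSlice_iff_exists_slice {H : ObstructionDesign} {x y : ℕ × ℕ × ℕ} (hx : x ∈ H)
    (hy : y ∈ H) : SameSlice x y ↔ ∃ (k : Fin 3) (i : ℕ), x ∈ H.slice k i ∧ y ∈ H.slice k i := by
  constructor
  · rintro ⟨k, hk⟩
    exact ⟨k, coord k x, mem_slice_self hx k, mem_slice.2 ⟨hy, hk.symm⟩⟩
  · rintro ⟨k, i, hxs, hys⟩
    exact ⟨k, (mem_slice.1 hxs).2.trans (mem_slice.1 hys).2.symm⟩

/-- "**If all slices contain at most `n` elements, we have `λ ⊢*_n d`**": the length bound on the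
type of `H` (`ℓ(λ⁽ᵏ⁾) ≤ n` for `k = 1, 2, 3`; `ℓ(λ⁽ᵏ⁾) = ᵗμ⁽ᵏ⁾₁` is the size of the largest
`k`-slice), rendered directly on the slices. [cite: BurgisserIkenmeyer2013, §4.1–§4.2] -/
def SlicesAtMost (H : ObstructionDesign) (n : ℕ) : Prop :=
  ∀ (k : Fin 3) (i : ℕ), (H.slice k i).card ≤ n

/-- A design all of whose slices are empty-or-bounded by `0` is empty.
[cite: BurgisserIkenmeyer2013, §4.2] -/
theorem eq_empty_of_slicesAtMost_zero {H : ObstructionDesign} (h : H.SlicesAtMost 0) :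
    H = ∅ := by
  refine Finset.eq_empty_of_forall_notMem fun x hx => ?_
  have h0 := h 0 (coord 0 x)
  have : 0 < (H.slice 0 (coord 0 x)).card := Finset.card_pos.2 ⟨x, mem_slice_self hx 0⟩
  omega

/-- A **proper coloring of `H` with `c` colors**: "a map `σ : H → [c]` such that in each slice of
`H`, the colors of points are pairwise different" (`σ` is a function on all points; only its values
on `H` matter, and they are `< c`). [cite: BurgisserIkenmeyer2013, §4.3] -/
def IsProperColoring (H : ObstructionDesign) (c : ℕ) (σ : ℕ × ℕ × ℕ → ℕ) : Prop :=
  (∀ x ∈ H, σ x < c) ∧ ∀ x ∈ H, ∀ y ∈ H, x ≠ y → SameSlice x y → σ x ≠ σ y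

/-- The **chromatic index** `χ'(H)`: "the least number of colors sufficient for coloring `H`".
[cite: BurgisserIkenmeyer2013, §4.3] -/
noncomputable def chromaticIndex (H : ObstructionDesign) : ℕ :=
  sInf {c | ∃ σ, H.IsProperColoring c σ}

/-- More colours keep a colouring proper. [cite: BurgisserIkenmeyer2013, §4.3] -/
theorem IsProperColoring.mono {H : ObstructionDesign} {c c' : ℕ} {σ : ℕ × ℕ × ℕ → ℕ}
    (h : H.IsProperColoring c σ) (hc : c ≤ c') : H.IsProperColoring c' σ :=
  ⟨fun x hx => (h.1 x hx).trans_le hc, h.2⟩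

/-- Colouring the points of `H` by `|H|` distinct colours is proper (so `χ'(H)` is well defined).
[cite: BurgisserIkenmeyer2013, §4.3] -/
theorem exists_isProperColoring_card (H : ObstructionDesign) : ∃ σ, H.IsProperColoring H.card σ := by
  classical
  refine ⟨fun x => if hx : x ∈ H then (H.equivFin ⟨x, hx⟩ : ℕ) else 0, ?_, ?_⟩
  · intro x hx
    simp only [hx, dite_true]
    exact (H.equivFin ⟨x, hx⟩).isLt
  · intro x hx y hy hxy _ hσ
    simp only [hx, hy, dite_true] at hσ
    have h := (H.equivFin).injective (Fin.ext hσ)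
    exact hxy (congrArg Subtype.val h)

/-- An optimal proper colouring exists: `H` has a proper colouring with `χ'(H)` colours.
[cite: BurgisserIkenmeyer2013, §4.3] -/
theorem exists_isProperColoring_chromaticIndex (H : ObstructionDesign) :
    ∃ σ, H.IsProperColoring H.chromaticIndex σ :=
  Nat.sInf_mem (s := {c | ∃ σ, H.IsProperColoring c σ}) ⟨H.card, H.exists_isProperColoring_card⟩

/-- A proper colouring with `c` colours bounds the chromatic index: `χ'(H) ≤ c`.
[cite: BurgisserIkenmeyer2013, §4.3] -/
theorem chromaticIndex_le_of_isProperColoring {H : ObstructionDesign} {c : ℕ} {σ : ℕ × ℕ × ℕ → ℕ}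
    (h : H.IsProperColoring c σ) : H.chromaticIndex ≤ c :=
  Nat.sInf_le ⟨σ, h⟩

/-- `χ'(H) ≤ |H|`. [cite: BurgisserIkenmeyer2013, §4.3] -/
theorem chromaticIndex_le_card (H : ObstructionDesign) : H.chromaticIndex ≤ H.card := by
  obtain ⟨σ, hσ⟩ := H.exists_isProperColoring_card
  exact chromaticIndex_le_of_isProperColoring hσ

/-- The chromatic index of the empty design is `0`. [cite: BurgisserIkenmeyer2013, §4.3] -/
theorem chromaticIndex_empty : chromaticIndex ∅ = 0 :=
  Nat.le_zero.1 (by simpa using chromaticIndex_le_card ∅)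

/-- If every two distinct points of `H` lie in a common slice, a proper colouring is injective on
`H`, so `|H| ≤ χ'(H)` (the mechanism behind "It is obvious that `χ'(H_κ) = 3κ+1`").
[cite: BurgisserIkenmeyer2013, §4.3–§4.4] -/
theorem card_le_chromaticIndex_of_pairwise_sameSlice {H : ObstructionDesign}
    (h : ∀ x ∈ H, ∀ y ∈ H, x ≠ y → SameSlice x y) : H.card ≤ H.chromaticIndex := by
  obtain ⟨σ, hσc, hσ⟩ := H.exists_isProperColoring_chromaticIndex
  calc H.card ≤ (Finset.range H.chromaticIndex).card :=
        Finset.card_le_card_of_injOn σ (fun x hx => Finset.mem_range.2 (hσc x hx))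
          (fun x hx y hy hxy => by
            by_contra hne
            exact hσ x hx y hy hne (h x hx y hy hne) hxy)
    _ = H.chromaticIndex := Finset.card_range _

/-! ## §3 The combinatorial half of Prop. 4.2: too few colours repeat inside a slice -/

/-- **"If `r = |T| < χ'(H)`, then a map `J : H → T` cannot be a proper coloring of `H`. Hence
there exists some `k` and some slice `e ∈ E⁽ᵏ⁾` in which two points get the same color."**
For `r < χ'(H)`, every labeling `σ` of the points of `H` by colours `< r` gives two distinct
points of a common slice the same colour. [cite: BurgisserIkenmeyer2013, Prop. 4.2 (proof)] -/
theorem exists_eq_of_lt_chromaticIndex {H : ObstructionDesign} {r : ℕ} (hr : r < H.chromaticIndex)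
    (σ : ℕ × ℕ × ℕ → ℕ) (hσ : ∀ x ∈ H, σ x < r) :
    ∃ x ∈ H, ∃ y ∈ H, x ≠ y ∧ SameSlice x y ∧ σ x = σ y := by
  by_contra hno
  push Not at hno
  have hprop : H.IsProperColoring r σ := ⟨hσ, fun x hx y hy hxy hs => hno x hx y hy hxy hs⟩
  exact absurd (chromaticIndex_le_of_isProperColoring hprop) (not_le.2 hr)

/-- The same, phrased with slices: for `r < χ'(H)` and any labeling by colours `< r`, some slice
of `H` contains two distinct points of the same colour. [cite: BurgisserIkenmeyer2013, Prop. 4.2 (proof)] -/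
theorem exists_slice_eq_of_lt_chromaticIndex {H : ObstructionDesign} {r : ℕ}
    (hr : r < H.chromaticIndex) (σ : ℕ × ℕ × ℕ → ℕ) (hσ : ∀ x ∈ H, σ x < r) :
    ∃ (k : Fin 3) (i : ℕ), ∃ x ∈ H.slice k i, ∃ y ∈ H.slice k i, x ≠ y ∧ σ x = σ y := by
  obtain ⟨x, hx, y, hy, hxy, hs, he⟩ := exists_eq_of_lt_chromaticIndex hr σ hσ
  obtain ⟨k, i, hxs, hys⟩ := (sameSlice_iff_exists_slice hx hy).1 hs
  exact ⟨k, i, x, hxs, y, hys, hxy, he⟩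

/-! ## §2 Lemma 4.3: the ceiling `χ'(H) ≤ 3n − 2` -/

/-- The points of `H` other than `x` lying in a common slice with `x` number at most `3(n−1)`
when all slices have at most `n` points ("Each node in this graph has degree at most
`Δ = 3(n−1)`, since there are at most `n` nodes in each slice").
[cite: BurgisserIkenmeyer2013, Lemma 4.3 (proof)] -/
theorem card_filter_sameSlice_le {H : ObstructionDesign} {n : ℕ} (hH : H.SlicesAtMost n)
    {x : ℕ × ℕ × ℕ} (hx : x ∈ H) :
    (H.filter fun y => y ≠ x ∧ SameSlice x y).card ≤ 3 * (n - 1) := by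
  classical
  calc (H.filter fun y => y ≠ x ∧ SameSlice x y).card
      ≤ ((Finset.univ : Finset (Fin 3)).biUnion fun k => (H.slice k (coord k x)).erase x).card := by
        refine Finset.card_le_card fun y hy => ?_
        obtain ⟨hyH, hyx, ⟨k, hk⟩⟩ := Finset.mem_filter.1 hy
        exact Finset.mem_biUnion.2
          ⟨k, Finset.mem_univ _, Finset.mem_erase.2 ⟨hyx, mem_slice.2 ⟨hyH, hk.symm⟩⟩⟩
    _ ≤ ∑ k : Fin 3, ((H.slice k (coord k x)).erase x).card := Finset.card_biUnion_le
    _ ≤ ∑ _k : Fin 3, (n - 1) := by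
        refine Finset.sum_le_sum fun k _ => ?_
        rw [Finset.card_erase_of_mem (mem_slice_self hx k)]
        exact Nat.sub_le_sub_right (hH k _) 1
    _ = 3 * (n - 1) := by simp

/-- **Bürgisser–Ikenmeyer 2013, Lemma 4.3** (verbatim: "We have `χ'(H) ≤ 3n −2` for any
obstruction design of type `λ ⊢*_n d`."): if all slices of `H` have at most `n` points, then
`χ'(H) ≤ 3n − 2`. The printed proof, followed here: the graph on `H` in which two points are
adjacent iff they lie in a common slice has maximum degree `≤ 3(n−1)`, and a graph of maximum
degree `Δ` is `(Δ+1)`-colourable (greedy colouring; tree theorem `colorable_maxDegree_succ` of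
`Literature/Combinatorics/SimpleGraph/WilfChromaticBound.lean`); a proper vertex colouring of
that graph is exactly a proper coloring of the design. (For `n = 0` the design is empty and both
sides are `0`.) [cite: BurgisserIkenmeyer2013, Lemma 4.3] -/
theorem chromaticIndex_le (H : ObstructionDesign) {n : ℕ} (hH : H.SlicesAtMost n) :
    H.chromaticIndex ≤ 3 * n - 2 := by
  classical
  rcases Nat.eq_zero_or_pos n with rfl | hn
  · rw [eq_empty_of_slicesAtMost_zero hH, chromaticIndex_empty]
  -- the conflict graph on the vertex set `H`
  let G : SimpleGraph H := SimpleGraph.fromRel fun x y => SameSlice x.1 y.1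
  haveI : DecidableRel G.Adj := Classical.decRel _
  -- every degree is at most `3(n-1)`
  have hdeg : ∀ v : H, G.degree v ≤ 3 * (n - 1) := by
    intro v
    rw [← SimpleGraph.card_neighborFinset_eq_degree, SimpleGraph.neighborFinset_eq_filter]
    calc (Finset.univ.filter fun w : H => G.Adj v w).card
        ≤ (H.filter fun y => y ≠ v.1 ∧ SameSlice v.1 y).card := by
          refine Finset.card_le_card_of_injOn (fun w : H => (w : ℕ × ℕ × ℕ)) ?_ ?_
          · intro w hw
            have hw' : G.Adj v w := (Finset.mem_filter.1 (Finset.mem_coe.1 hw)).2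
            obtain ⟨hne, hs⟩ := (SimpleGraph.fromRel_adj _ v w).1 hw'
            refine Finset.mem_coe.2 (Finset.mem_filter.2 ⟨w.2, ?_, ?_⟩)
            · exact fun h => hne (Subtype.ext h).symm
            · exact hs.elim id SameSlice.symm
          · exact fun w _ w' _ h => Subtype.ext h
      _ ≤ 3 * (n - 1) := card_filter_sameSlice_le hH v.2
  have hmax : G.maxDegree ≤ 3 * (n - 1) := G.maxDegree_le_of_forall_degree_le (3 * (n - 1)) hdeg
  -- greedy colouring with `Δ + 1 ≤ 3(n-1) + 1 = 3n - 2` colours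
  have hcol : G.Colorable (3 * n - 2) :=
    (Literature.Combinatorics.SimpleGraph.WilfChromaticBound.colorable_maxDegree_succ G).mono
      (by omega)
  obtain ⟨C, hC⟩ := (SimpleGraph.colorable_iff_exists_bdd_nat_coloring _).1 hcol
  -- read it as a proper coloring of the design
  refine chromaticIndex_le_of_isProperColoring (σ := fun x => if hx : x ∈ H then C ⟨x, hx⟩ else 0)
    ⟨fun x hx => ?_, fun x hx y hy hxy hs => ?_⟩
  · simp only [hx, dite_true]
    exact hC _
  · simp only [hx, hy, dite_true]
    refine C.valid ((SimpleGraph.fromRel_adj _ _ _).2 ⟨?_, Or.inl hs⟩)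
    exact fun h => hxy (congrArg Subtype.val h)

/-- **"This result shows that `3n−2` is the best lower bound on border rank that can be shown based
on Proposition 4.2."** For a design all of whose slices have at most `n` points and any
`r ≥ 3n − 2`, the hypothesis `r < χ'(H)` of Prop. 4.2 fails — so the chromatic-index method
certifies `f_H(w) = 0` at best for the tensors of border rank `< 3n − 2`, i.e. it proves at
best `R̲(w) ≥ 3n − 2`. (The next printed sentence, on the Alon–Kim conjecture
lowering this ceiling to `(3/2)n + o(n)`, is a conjecture and is not recorded as a statement.)
[cite: BurgisserIkenmeyer2013, §4.3 (after Lemma 4.3)] -/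
theorem not_lt_chromaticIndex_of_le (H : ObstructionDesign) {n r : ℕ} (hH : H.SlicesAtMost n)
    (hr : 3 * n - 2 ≤ r) : ¬ r < H.chromaticIndex :=
  not_lt.2 ((H.chromaticIndex_le hH).trans hr)

/-! ## §4 The "3-dimensional hook" `H_κ` -/

/-- **The obstruction design `H_κ`** of BI §4.4 ("a '3-dimensional hook'"): the union of the three
coordinate axes of the cube `[κ+1]³` through its corner — in `0`-based coordinates the points
`(i,0,0)`, `(0,j,0)`, `(0,0,k)` with `i, j, k ≤ κ`. Printed as
"`H_κ := {(i,j,k) ∈ [κ+1]³ ∣ i = 1 or j = 1 or k = 1}`"; the set so written has `3κ²+3κ+1` points,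
while the type `λ(κ)` = three hooks `(κ+1, 1^{2κ}) ⊢ 3κ+1` printed in the same sentence, and the
description of `H_κ` in §6 ("`V⁽¹⁾ ∪ V⁽²⁾ ∪ V⁽³⁾ ∪ {y⁰}`, `|V⁽ᵏ⁾| = κ`", each `E⁽ᵏ⁾` = one slice of
size `2κ+1` and `κ` singletons), force the reading "at least two of `i, j, k` equal `1`", which is
this set (module docstring). [cite: BurgisserIkenmeyer2013, §4.4 and §6] -/
def hookDesign (κ : ℕ) : ObstructionDesign :=
  (Finset.range (κ + 1)).image (fun i => (i, 0, 0)) ∪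
    ((Finset.range (κ + 1)).image (fun j => (0, j, 0)) ∪
      (Finset.range (κ + 1)).image (fun k => (0, 0, k)))

/-- Membership in `H_κ`: at least two coordinates vanish and the third is `≤ κ`.
[cite: BurgisserIkenmeyer2013, §4.4] -/
theorem mem_hookDesign {κ : ℕ} {x : ℕ × ℕ × ℕ} :
    x ∈ hookDesign κ ↔ (x.1 ≤ κ ∧ x.2.1 = 0 ∧ x.2.2 = 0) ∨ (x.1 = 0 ∧ x.2.1 ≤ κ ∧ x.2.2 = 0) ∨
      (x.1 = 0 ∧ x.2.1 = 0 ∧ x.2.2 ≤ κ) := by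
  obtain ⟨a, b, c⟩ := x
  simp only [hookDesign, Finset.mem_union, Finset.mem_image, Finset.mem_range, Prod.mk.injEq]
  constructor
  · rintro (⟨i, hi, rfl, rfl, rfl⟩ | ⟨j, hj, rfl, rfl, rfl⟩ | ⟨k, hk, rfl, rfl, rfl⟩)
    · exact Or.inl ⟨by omega, rfl, rfl⟩
    · exact Or.inr (Or.inl ⟨rfl, by omega, rfl⟩)
    · exact Or.inr (Or.inr ⟨rfl, rfl, by omega⟩)
  · rintro (⟨ha, rfl, rfl⟩ | ⟨rfl, hb, rfl⟩ | ⟨rfl, rfl, hc⟩)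
    · exact Or.inl ⟨a, by omega, rfl, rfl, rfl⟩
    · exact Or.inr (Or.inl ⟨b, by omega, rfl, rfl, rfl⟩)
    · exact Or.inr (Or.inr ⟨c, by omega, rfl, rfl, rfl⟩)

/-- `|H_κ| = 3κ + 1` (`= |λ(κ)|`, the degree `d` of Rem. 4.7). [cite: BurgisserIkenmeyer2013, §4.4] -/
theorem card_hookDesign (κ : ℕ) : (hookDesign κ).card = 3 * κ + 1 := by
  classical
  -- split off the corner: the three positive half-axes are pairwise disjoint
  have h1 : hookDesign κ = insert ((0 : ℕ), (0 : ℕ), (0 : ℕ))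
      (((Finset.range κ).image fun i => (i + 1, 0, 0)) ∪
        (((Finset.range κ).image fun j => (0, j + 1, 0)) ∪
          ((Finset.range κ).image fun k => (0, 0, k + 1)))) := by
    ext ⟨a, b, c⟩
    simp only [mem_hookDesign, Finset.mem_insert, Finset.mem_union, Finset.mem_image,
      Finset.mem_range, Prod.mk.injEq]
    constructor
    · rintro (⟨ha, rfl, rfl⟩ | ⟨rfl, hb, rfl⟩ | ⟨rfl, rfl, hc⟩)
      · rcases Nat.eq_zero_or_pos a with rfl | hpos
        · exact Or.inl ⟨rfl, rfl, rfl⟩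
        · exact Or.inr (Or.inl ⟨a - 1, by omega, by omega, rfl, rfl⟩)
      · rcases Nat.eq_zero_or_pos b with rfl | hpos
        · exact Or.inl ⟨rfl, rfl, rfl⟩
        · exact Or.inr (Or.inr (Or.inl ⟨b - 1, by omega, rfl, by omega, rfl⟩))
      · rcases Nat.eq_zero_or_pos c with rfl | hpos
        · exact Or.inl ⟨rfl, rfl, rfl⟩
        · exact Or.inr (Or.inr (Or.inr ⟨c - 1, by omega, rfl, rfl, by omega⟩))
    · rintro (⟨rfl, rfl, rfl⟩ | ⟨i, hi, rfl, rfl, rfl⟩ | ⟨j, hj, rfl, rfl, rfl⟩ | ⟨k, hk, rfl, rfl, rfl⟩)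
      · exact Or.inl ⟨by omega, rfl, rfl⟩
      · exact Or.inl ⟨by omega, rfl, rfl⟩
      · exact Or.inr (Or.inl ⟨rfl, by omega, rfl⟩)
      · exact Or.inr (Or.inr ⟨rfl, rfl, by omega⟩)
  rw [h1, Finset.card_insert_of_notMem, Finset.card_union_of_disjoint,
    Finset.card_union_of_disjoint, Finset.card_image_of_injective, Finset.card_image_of_injective,
    Finset.card_image_of_injective, Finset.card_range]
  · ring
  · intro k k' h
    simpa using h
  · intro j j' h
    simpa using h
  · intro i i' h
    simpa using h
  · rw [Finset.disjoint_left]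
    rintro ⟨a, b, c⟩ h h'
    simp only [Finset.mem_image, Finset.mem_range, Prod.mk.injEq] at h h'
    obtain ⟨j, -, -, rfl, -⟩ := h
    obtain ⟨k, -, -, hb, -⟩ := h'
    omega
  · rw [Finset.disjoint_left]
    rintro ⟨a, b, c⟩ h h'
    simp only [Finset.mem_image, Finset.mem_range, Finset.mem_union, Prod.mk.injEq] at h h'
    obtain ⟨i, -, rfl, -, -⟩ := h
    rcases h' with ⟨j, -, ha, -, -⟩ | ⟨k, -, ha, -, -⟩ <;> omega
  · simp only [Finset.mem_union, Finset.mem_image, Finset.mem_range, Prod.mk.injEq, not_or,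
      not_exists, not_and]
    refine ⟨fun i _ h => ?_, fun j _ _ h => ?_, fun k _ _ _ h => ?_⟩ <;> omega

/-- Every two points of `H_κ` lie in a common slice (two points on one axis agree in the two
other coordinates; points on different axes agree in the third coordinate).
[cite: BurgisserIkenmeyer2013, §4.4] -/
theorem sameSlice_of_mem_hookDesign {κ : ℕ} {x y : ℕ × ℕ × ℕ} (hx : x ∈ hookDesign κ)
    (hy : y ∈ hookDesign κ) : SameSlice x y := by
  rw [sameSlice_iff]
  rw [mem_hookDesign] at hx hy
  omega

/-- The slices of `H_κ` have at most `2κ + 1` points (the big slice `e⁽ᵏ⁾` through the corner has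
exactly `2κ+1`, the others are singletons), so the type of `H_κ` is `⊢*_{2κ+1}` — as printed:
`λ(κ)` has components of length `2κ + 1`. [cite: BurgisserIkenmeyer2013, §4.4 and §6] -/
theorem slicesAtMost_hookDesign (κ : ℕ) : (hookDesign κ).SlicesAtMost (2 * κ + 1) := by
  classical
  intro k i
  -- a slice misses at least `κ` points of one of the two other axes... we bound directly:
  -- the slice through coordinate `k = i` is contained in the corner plus the two other axes when
  -- `i = 0`, and is a single point when `i ≠ 0`.
  by_cases hi : i = 0
  · subst hi
    -- remove the `κ` points of the `k`-th axis with positive coordinate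
    have hsub : (hookDesign κ).slice k 0 ⊆
        (hookDesign κ) \ ((Finset.range κ).image fun t : ℕ =>
          ((if k = 0 then t + 1 else 0, if k = 1 then t + 1 else 0, if k = 2 then t + 1 else 0) :
            ℕ × ℕ × ℕ)) := by
      intro x hx
      obtain ⟨hxH, hxk⟩ := mem_slice.1 hx
      refine Finset.mem_sdiff.2 ⟨hxH, fun hmem => ?_⟩
      obtain ⟨t, -, rfl⟩ := Finset.mem_image.1 hmem
      fin_cases k <;> simp [coord] at hxk
    refine (Finset.card_le_card hsub).trans ?_
    rw [Finset.card_sdiff_of_subset, Finset.card_image_of_injective, Finset.card_range, card_hookDesign]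
    · omega
    · intro t t' h
      fin_cases k <;> simpa using h
    · intro x hx
      obtain ⟨t, ht, rfl⟩ := Finset.mem_image.1 hx
      rw [Finset.mem_range] at ht
      rw [mem_hookDesign]
      fin_cases k <;> simp <;> omega
  · -- a slice off the corner planes: at most one point
    refine le_trans (Finset.card_le_one.2 fun x hx y hy => ?_) (by omega)
    obtain ⟨hxH, hxk⟩ := mem_slice.1 hx
    obtain ⟨hyH, hyk⟩ := mem_slice.1 hy
    obtain ⟨a, b, c⟩ := x
    obtain ⟨a', b', c'⟩ := y
    simp only [mem_hookDesign] at hxH hyH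
    fin_cases k <;> simp [coord] at hxk hyk <;> simp only [Prod.mk.injEq] <;> omega

/-- **"It is obvious that `χ'(H_κ) = 3κ+1`"**: every two points of `H_κ` share a slice, so a
proper coloring is injective on the `3κ+1` points, and `3κ+1` colours always suffice.
[cite: BurgisserIkenmeyer2013, §4.4] -/
theorem chromaticIndex_hookDesign (κ : ℕ) : (hookDesign κ).chromaticIndex = 3 * κ + 1 := by
  refine le_antisymm ?_ ?_
  · rw [← card_hookDesign]
    exact chromaticIndex_le_card _
  · rw [← card_hookDesign]
    exact card_le_chromaticIndex_of_pairwise_sameSlice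
      fun x hx y hy _ => sameSlice_of_mem_hookDesign hx hy

end ObstructionDesign

/-! ## §5 The dictionary to triples of standard tableaux, Lemma 4.3 and Prop. 4.2 for them -/

section Tableaux

open ObstructionDesign
open Literature.NumberTheory.DiophantineGeometry (Word StdFilling)

variable {n d : ℕ} {Y₁ Y₂ Y₃ : YoungDiagram}

/-- The **column triple** of a position `p < d` in a triple of standard fillings: the point
`(col_{T₁} p, col_{T₂} p, col_{T₃} p)` of `ℕ³`. In BI's dictionary (Thm. 4.1 / §5) the `k`-slices
of a design are the blocks `e ∈ E⁽ᵏ⁾`, each evaluated by a column determinant `det J⁽ᵏ⁾|e`, i.e.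
the columns of the `k`-th tableau. [cite: BurgisserIkenmeyer2013, §4.2 and Thm. 4.1] -/
def colTriple (T₁ : StdFilling d Y₁) (T₂ : StdFilling d Y₂) (T₃ : StdFilling d Y₃) (p : Fin d) :
    ℕ × ℕ × ℕ :=
  ((T₁.1 p).2, (T₂.1 p).2, (T₃.1 p).2)

/-- The **design of a tableau triple**: the set of column triples of the `d` positions. It is an
obstruction design with `|H| ≤ d` points, `= d` exactly when the column-triple map is injective —
BI's intersection property "`|e⁽¹⁾ ∩ e⁽²⁾ ∩ e⁽³⁾| ≤ 1`" for a set of points.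
[cite: BurgisserIkenmeyer2013, §4.2 and Thm. 4.1] -/
def designOf (T₁ : StdFilling d Y₁) (T₂ : StdFilling d Y₂) (T₃ : StdFilling d Y₃) :
    ObstructionDesign :=
  Finset.univ.image (colTriple T₁ T₂ T₃)

/-- The coordinates of a column triple are the three columns. [cite: BurgisserIkenmeyer2013, §4.2] -/
theorem coord_colTriple (T₁ : StdFilling d Y₁) (T₂ : StdFilling d Y₂) (T₃ : StdFilling d Y₃)
    (p : Fin d) (k : Fin 3) :
    coord k (colTriple T₁ T₂ T₃ p) = ![(T₁.1 p).2, (T₂.1 p).2, (T₃.1 p).2] k := by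
  fin_cases k <;> rfl

/-- Two positions have column triples in a common slice iff they share a column in one of the
three tableaux. [cite: BurgisserIkenmeyer2013, §4.2] -/
theorem sameSlice_colTriple_iff (T₁ : StdFilling d Y₁) (T₂ : StdFilling d Y₂)
    (T₃ : StdFilling d Y₃) (p q : Fin d) :
    SameSlice (colTriple T₁ T₂ T₃ p) (colTriple T₁ T₂ T₃ q) ↔
      (T₁.1 p).2 = (T₁.1 q).2 ∨ (T₂.1 p).2 = (T₂.1 q).2 ∨ (T₃.1 p).2 = (T₃.1 q).2 := by
  rw [sameSlice_iff]
  rfl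

/-- The positions of one column of a standard filling of a diagram with at most `n` rows number
at most `n` (the filling is injective into the cells `(r, c)`, `r < n`, of that column).
[cite: BurgisserIkenmeyer2013, Lemma 4.3 (proof: "there are at most `n` nodes in each slice")] -/
theorem card_filter_col_eq_le {Y : YoungDiagram} (hN : ∀ x ∈ Y.cells, x.1 < n)
    (T : StdFilling d Y) (c : ℕ) :
    (Finset.univ.filter fun p : Fin d => (T.1 p).2 = c).card ≤ n := by
  classical
  calc (Finset.univ.filter fun p : Fin d => (T.1 p).2 = c).card
      ≤ (Finset.range n).card := by
        refine Finset.card_le_card_of_injOn (fun p => (T.1 p).1) ?_ ?_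
        · intro p hp
          exact Finset.mem_coe.2 (Finset.mem_range.2
            (hN _ ((YoungDiagram.mem_cells _).2 (T.mem p))))
        · intro p hp q hq h
          have hpc : (T.1 p).2 = c := (Finset.mem_filter.1 (Finset.mem_coe.1 hp)).2
          have hqc : (T.1 q).2 = c := (Finset.mem_filter.1 (Finset.mem_coe.1 hq)).2
          exact T.injective (Prod.ext h (hpc.trans hqc.symm))
    _ = n := Finset.card_range n

/-- **The slices of the design of a tableau triple are bounded by the number of rows**: if the
three diagrams have at most `n` rows, every slice of `designOf T₁ T₂ T₃` has at most `n` points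
(the `k`-slice through `c` is the image of the positions in column `c` of `T_k`). So the design is
of type `⊢*_n` in BI's sense. [cite: BurgisserIkenmeyer2013, §4.2 ("If all slices contain at most `n` elements, we have `λ ⊢*_n d`")] -/
theorem slicesAtMost_designOf (hN₁ : ∀ x ∈ Y₁.cells, x.1 < n) (hN₂ : ∀ x ∈ Y₂.cells, x.1 < n)
    (hN₃ : ∀ x ∈ Y₃.cells, x.1 < n) (T₁ : StdFilling d Y₁) (T₂ : StdFilling d Y₂)
    (T₃ : StdFilling d Y₃) : (designOf T₁ T₂ T₃).SlicesAtMost n := by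
  classical
  intro k c
  -- the `k`-slice through `c` is the image of the positions in column `c` of `T_k`
  have himg : (designOf T₁ T₂ T₃).slice k c ⊆
      (Finset.univ.filter fun p : Fin d => coord k (colTriple T₁ T₂ T₃ p) = c).image
        (colTriple T₁ T₂ T₃) := by
    intro x hx
    obtain ⟨hxH, hxc⟩ := mem_slice.1 hx
    obtain ⟨p, -, rfl⟩ := Finset.mem_image.1 hxH
    exact Finset.mem_image.2 ⟨p, Finset.mem_filter.2 ⟨Finset.mem_univ _, hxc⟩, rfl⟩
  refine (Finset.card_le_card himg).trans (Finset.card_image_le.trans ?_)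
  fin_cases k
  · simpa [coord_colTriple] using card_filter_col_eq_le hN₁ T₁ c
  · simpa [coord_colTriple] using card_filter_col_eq_le hN₂ T₂ c
  · simpa [coord_colTriple] using card_filter_col_eq_le hN₃ T₃ c

/-- **Lemma 4.3 for tableau triples**: with at most `n` rows in each of the three diagrams,
`χ'(designOf T₁ T₂ T₃) ≤ 3n − 2`. [cite: BurgisserIkenmeyer2013, Lemma 4.3] -/
theorem chromaticIndex_designOf_le (hN₁ : ∀ x ∈ Y₁.cells, x.1 < n)
    (hN₂ : ∀ x ∈ Y₂.cells, x.1 < n) (hN₃ : ∀ x ∈ Y₃.cells, x.1 < n) (T₁ : StdFilling d Y₁)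
    (T₂ : StdFilling d Y₂) (T₃ : StdFilling d Y₃) :
    (designOf T₁ T₂ T₃).chromaticIndex ≤ 3 * n - 2 :=
  chromaticIndex_le _ (slicesAtMost_designOf hN₁ hN₂ hN₃ T₁ T₂ T₃)

/-- **Prop. 4.2's combinatorial step for tableau triples.** If the column-triple map is injective
(a genuine design on `d` points) and `r < χ'(designOf T₁ T₂ T₃)`, then every labeling
`I : [d] → [r]` gives two distinct positions of a common column (of `T₁`, `T₂` or `T₃`) the same
label. [cite: BurgisserIkenmeyer2013, Prop. 4.2 (proof)] -/
theorem exists_apply_eq_of_lt_chromaticIndex_designOf {r : ℕ} (T₁ : StdFilling d Y₁)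
    (T₂ : StdFilling d Y₂) (T₃ : StdFilling d Y₃)
    (hinj : Function.Injective (colTriple T₁ T₂ T₃))
    (hr : r < (designOf T₁ T₂ T₃).chromaticIndex) (I : Fin d → Fin r) :
    ∃ p q : Fin d, p ≠ q ∧ I p = I q ∧
      ((T₁.1 p).2 = (T₁.1 q).2 ∨ (T₂.1 p).2 = (T₂.1 q).2 ∨ (T₃.1 p).2 = (T₃.1 q).2) := by
  classical
  -- transport `I` to a colouring of the points of the design
  let σ : ℕ × ℕ × ℕ → ℕ := fun x =>
    if hx : ∃ p, colTriple T₁ T₂ T₃ p = x then (I (Classical.choose hx) : ℕ) else 0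
  have hσp : ∀ p, σ (colTriple T₁ T₂ T₃ p) = I p := by
    intro p
    have hx : ∃ q, colTriple T₁ T₂ T₃ q = colTriple T₁ T₂ T₃ p := ⟨p, rfl⟩
    simp only [σ, hx, dite_true]
    rw [hinj (Classical.choose_spec hx)]
  have hσ : ∀ x ∈ designOf T₁ T₂ T₃, σ x < r := by
    intro x hx
    obtain ⟨p, -, rfl⟩ := Finset.mem_image.1 hx
    rw [hσp]
    exact (I p).isLt
  obtain ⟨x, hx, y, hy, hxy, hs, he⟩ := exists_eq_of_lt_chromaticIndex hr σ hσ
  obtain ⟨p, -, rfl⟩ := Finset.mem_image.1 hx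
  obtain ⟨q, -, rfl⟩ := Finset.mem_image.1 hy
  refine ⟨p, q, fun h => hxy (by rw [h]), Fin.ext (by rw [← hσp p, ← hσp q, he]),
    (sameSlice_colTriple_iff T₁ T₂ T₃ p q).1 hs⟩

/-- **Bürgisser–Ikenmeyer 2013, Prop. 4.2, in the tree's occurrence language.** Let `T₁, T₂, T₃`
be standard fillings of diagrams with at most `r` rows by the positions `0, …, d−1`, and suppose
`r < χ'(H)` for their design `H = designOf T₁ T₂ T₃`. Then for all `r × r` matrices `A, B, C`
the pairing of `((A⊗B⊗C)·⟨r⟩)^{⊗d}` with `e_{T₁} ⊗ e_{T₂} ⊗ e_{T₃}`,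
`∑_{I : [d] → [r]} ⟨⊗_m a_{I m}, e_{T₁}⟩ ⟨⊗_m b_{I m}, e_{T₂}⟩ ⟨⊗_m c_{I m}, e_{T₃}⟩`
(`pairing_unitTensor_eq_sum`), vanishes: if the column-triple map is injective (a genuine design),
every `I` repeats a label inside a column of some `T_k` (Prop. 4.2's step) and that factor is a
"determinant with a duplicated column" (`sum_prod_mul_polytabloid_eq_zero_of_apply_eq`); if it is
not injective, two positions share a column in all three tableaux and the sum vanishes by the
antisymmetry `tripleSum_eq_zero_of_common_column`. This is "`f_H(w) = 0` for all tensors `w` with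
`R̲(w) < χ'(H)`" read on `\overline{GL_r³ E_r}` (`R̲(w) ≤ r` iff `w ∈ \overline{GL_r³ E_r}`,
BI §2.1; the format is taken to be `r`, as in Rem. 4.7's "Put `n := 3κ`" — occurrence of a type
does not depend on the ambient format, Bürgisser–Ikenmeyer 2011 Prop. 3.3, so nothing is lost).
[cite: BurgisserIkenmeyer2013, Prop. 4.2] -/
theorem tripleSum_eq_zero_of_lt_chromaticIndex {r : ℕ} (hN₁ : ∀ x ∈ Y₁.cells, x.1 < r)
    (hN₂ : ∀ x ∈ Y₂.cells, x.1 < r) (hN₃ : ∀ x ∈ Y₃.cells, x.1 < r) (T₁ : StdFilling d Y₁)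
    (T₂ : StdFilling d Y₂) (T₃ : StdFilling d Y₃)
    (hr : r < (designOf T₁ T₂ T₃).chromaticIndex) (A B C : Matrix (Fin r) (Fin r) ℂ) :
    ∑ I : Fin d → Fin r, (∑ u : Word r d, (∏ m, A (u m) (I m)) * T₁.polytabloid ℂ hN₁ u) *
        (∑ v : Word r d, (∏ m, B (v m) (I m)) * T₂.polytabloid ℂ hN₂ v) *
        (∑ w : Word r d, (∏ m, C (w m) (I m)) * T₃.polytabloid ℂ hN₃ w) = 0 := by
  classical
  by_cases hinj : Function.Injective (colTriple T₁ T₂ T₃)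
  · refine Finset.sum_eq_zero fun I _ => ?_
    obtain ⟨p, q, hpq, hI, h⟩ := exists_apply_eq_of_lt_chromaticIndex_designOf T₁ T₂ T₃ hinj hr I
    rcases h with h | h | h
    · rw [sum_prod_mul_polytabloid_eq_zero_of_apply_eq hN₁ T₁ hpq h A hI, zero_mul, zero_mul]
    · rw [sum_prod_mul_polytabloid_eq_zero_of_apply_eq hN₂ T₂ hpq h B hI, mul_zero, zero_mul]
    · rw [sum_prod_mul_polytabloid_eq_zero_of_apply_eq hN₃ T₃ hpq h C hI, mul_zero]
  · -- two positions with the same column triple: the antisymmetry argument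
    obtain ⟨p, q, hne, heq⟩ : ∃ p q, p ≠ q ∧ colTriple T₁ T₂ T₃ p = colTriple T₁ T₂ T₃ q := by
      simp only [Function.Injective, not_forall] at hinj
      obtain ⟨p, q, h, hne⟩ := hinj
      exact ⟨p, q, hne, h⟩
    simp only [colTriple, Prod.mk.injEq] at heq
    exact tripleSum_eq_zero_of_common_column hN₁ hN₂ hN₃ T₁ T₂ T₃ hne heq.1 heq.2.1 heq.2.2 A B C

/-- **The ceiling for tableau triples** ("`3n−2` is the best lower bound on border rank that can
be shown based on Proposition 4.2"): with at most `n` rows, no tableau triple has a design with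
`χ' > r` once `r ≥ 3n − 2`, so `tripleSum_eq_zero_of_lt_chromaticIndex` never applies there.
[cite: BurgisserIkenmeyer2013, §4.3 (after Lemma 4.3)] -/
theorem not_lt_chromaticIndex_designOf (hN₁ : ∀ x ∈ Y₁.cells, x.1 < n)
    (hN₂ : ∀ x ∈ Y₂.cells, x.1 < n) (hN₃ : ∀ x ∈ Y₃.cells, x.1 < n) (T₁ : StdFilling d Y₁)
    (T₂ : StdFilling d Y₂) (T₃ : StdFilling d Y₃) {r : ℕ} (hr : 3 * n - 2 ≤ r) :
    ¬ r < (designOf T₁ T₂ T₃).chromaticIndex :=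
  not_lt_chromaticIndex_of_le _ (slicesAtMost_designOf hN₁ hN₂ hN₃ T₁ T₂ T₃) hr

end Tableaux

end Literature.Computability.AlgebraicComplexity
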